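import Summits.RiemannHypothesis.RiemannHypothesis.Theorems.SemilocalPiecewiseIncrement
import HarnessLib

/-!
# Semi-local thresholds, negative side (IVc′): PIECEWISE polynomial Markov witnesses, part 2b — sums of cross terms and the
  increment identity on `t`-pieces

Cell `rh-explicit` (HOME `run/shared/lean/pub/rh-explicit/`), seat cc-s2-4 gen8 (continuation of `SemilocalPiecewiseIncrement.lean`, split
for the 400-line rule).  Honest framing: bookkeeping; nothing here bears on RH.  No data trusted.

From the one-pair cross term of part 2a (`integral_cross_eq`): the row/double sums `crossRowL`, `crossSumL` (`none` if any pair is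
invalid on the piece) and `integral_crossSum_eq : ∫ F_P(x+t)·F_Q(x) dx = ev C t`; the autocorrelation of the odd witness
`∫ G(x+t)G(x) = 2∫F(x+t)F(x) − ∫F(x+t)F(−x)` (`integral_pwG_shift_mul`; the term `∫F(−x−t)F(x)` vanishes for `t ≥ 0`); the increment list
`pwIncrementL P T₀ T₁ = 4N − 4ΣC(P,P) + 2ΣC(P, mirror P)` and **`weilIncrement_pwWitness_eq`**: `pwIncrementL P T₀ T₁ = some D → 0 ≤ T₀ →
t ∈ [T₀, T₁] → weilIncrement (pwWitness P) t = ev D t`; `weilIncrement_pwWitness_eq_of_lt` (`t > 2b`: `D = 4N = 2‖G‖²`).  Kernel regression: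
the single piece `(0, 1, x)` reproduces `incrementL [0,1] 1`.  Folklore throughout.
-/

set_option autoImplicit false
set_option linter.dupNamespace false  -- the mandated namespace repeats `RiemannHypothesis`

noncomputable section

open Complex Filter Set MeasureTheory Topology
open scoped Real

namespace Summit.RiemannHypothesis.RiemannHypothesis.Theorems.SemilocalPolyWitness

open MeasureTheory Set Finset Real
open Literature.NumberTheory.LFunctions
open Summit.RiemannHypothesis.RiemannHypothesis.Theorems.MotivicDoor
open LQ

/-! ## Sums of cross terms -/

/-- `Σ_{J ∈ Q} crossTermL I J` on `[T₀, T₁]` (`none` if any pair is invalid). -/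
def crossRowL (I : Pw) (T0 T1 : ℚ) : List Pw → Option (List ℚ)
  | [] => some []
  | J :: Q => match crossTermL I J T0 T1, crossRowL I T0 T1 Q with
    | some C, some R => some (add C R)
    | _, _ => none

/-- `Σ_{I ∈ P} Σ_{J ∈ Q} crossTermL I J` on `[T₀, T₁]`. -/
def crossSumL (T0 T1 : ℚ) : List Pw → List Pw → Option (List ℚ)
  | [], _ => some []
  | I :: P, Q => match crossRowL I T0 T1 Q, crossSumL T0 T1 P Q with
    | some R, some C => some (add R C)
    | _, _ => none

/-- One cross integrand is integrable. -/
theorem integrable_cross (I J : Pw) (t : ℝ) :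
    Integrable fun x ↦ (Icc (I.lo : ℝ) I.hi).indicator (ev I.p) (x + t) * (Icc (J.lo : ℝ) J.hi).indicator (ev J.p) x := by
  simp_rw [indicator_shift_mul I J t]
  exact ((((continuous_ev I.p).comp (continuous_add_const t)).mul (continuous_ev J.p)).integrableOn_Icc).integrable_indicator
    measurableSet_Icc

/-- A shifted piece times `pwF Q` is integrable. -/
theorem integrable_indicator_mul_pwF (I : Pw) (t : ℝ) : ∀ Q : List Pw,
    Integrable fun x ↦ (Icc (I.lo : ℝ) I.hi).indicator (ev I.p) (x + t) * pwF Q x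
  | [] => by simp [pwF]
  | J :: Q => by
      have e : (fun x ↦ (Icc (I.lo : ℝ) I.hi).indicator (ev I.p) (x + t) * pwF (J :: Q) x) =
          fun x ↦ (Icc (I.lo : ℝ) I.hi).indicator (ev I.p) (x + t) * (Icc (J.lo : ℝ) J.hi).indicator (ev J.p) x +
            (Icc (I.lo : ℝ) I.hi).indicator (ev I.p) (x + t) * pwF Q x := by
        funext x; simp only [pwF]; ring
      rw [e]
      exact (integrable_cross I J t).add (integrable_indicator_mul_pwF I t Q)

/-- `pwF P (· + t) · pwF Q` is integrable. -/
theorem integrable_pwF_shift_mul_pwF (t : ℝ) : ∀ P Q : List Pw, Integrable fun x ↦ pwF P (x + t) * pwF Q x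
  | [], Q => by simp [pwF]
  | I :: P, Q => by
      have e : (fun x ↦ pwF (I :: P) (x + t) * pwF Q x) =
          fun x ↦ (Icc (I.lo : ℝ) I.hi).indicator (ev I.p) (x + t) * pwF Q x + pwF P (x + t) * pwF Q x := by
        funext x; simp only [pwF]; ring
      rw [e]
      exact (integrable_indicator_mul_pwF I t Q).add (integrable_pwF_shift_mul_pwF t P Q)

/-- The row sum is the integral of a shifted piece against `pwF Q`. -/
theorem integral_crossRow_eq (I : Pw) {T0 T1 : ℚ} {t : ℝ} (ht : t ∈ Icc (T0 : ℝ) T1) :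
    ∀ {Q : List Pw} {R : List ℚ}, crossRowL I T0 T1 Q = some R →
      ∫ x, (Icc (I.lo : ℝ) I.hi).indicator (ev I.p) (x + t) * pwF Q x = ev R t
  | [], R, h => by simp [crossRowL] at h; subst h; simp [pwF]
  | J :: Q, R, h => by
      simp only [crossRowL] at h
      cases hC : crossTermL I J T0 T1 with
      | none => simp [hC] at h
      | some C =>
        cases hR : crossRowL I T0 T1 Q with
        | none => simp [hC, hR] at h
        | some R' =>
          simp only [hC, hR, Option.some.injEq] at h
          subst h
          have e : (fun x ↦ (Icc (I.lo : ℝ) I.hi).indicator (ev I.p) (x + t) * pwF (J :: Q) x) =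
              fun x ↦ (Icc (I.lo : ℝ) I.hi).indicator (ev I.p) (x + t) * (Icc (J.lo : ℝ) J.hi).indicator (ev J.p) x +
                (Icc (I.lo : ℝ) I.hi).indicator (ev I.p) (x + t) * pwF Q x := by
            funext x; simp only [pwF]; ring
          rw [e, integral_add (integrable_cross I J t) (integrable_indicator_mul_pwF I t Q), integral_cross_eq hC ht,
            integral_crossRow_eq I ht hR, ev_add]

/-- **The double sum is `∫ F_P(x+t)·F_Q(x) dx`.** -/
theorem integral_crossSum_eq {T0 T1 : ℚ} {t : ℝ} (ht : t ∈ Icc (T0 : ℝ) T1) :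
    ∀ {P Q : List Pw} {C : List ℚ}, crossSumL T0 T1 P Q = some C → ∫ x, pwF P (x + t) * pwF Q x = ev C t
  | [], Q, C, h => by simp [crossSumL] at h; subst h; simp [pwF]
  | I :: P, Q, C, h => by
      simp only [crossSumL] at h
      cases hR : crossRowL I T0 T1 Q with
      | none => simp [hR] at h
      | some R =>
        cases hC : crossSumL T0 T1 P Q with
        | none => simp [hR, hC] at h
        | some C' =>
          simp only [hR, hC, Option.some.injEq] at h
          subst h
          have e : (fun x ↦ pwF (I :: P) (x + t) * pwF Q x) =
              fun x ↦ (Icc (I.lo : ℝ) I.hi).indicator (ev I.p) (x + t) * pwF Q x + pwF P (x + t) * pwF Q x := by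
            funext x; simp only [pwF]; ring
          rw [e, integral_add (integrable_indicator_mul_pwF I t Q) (integrable_pwF_shift_mul_pwF t P Q),
            integral_crossRow_eq I ht hR, integral_crossSum_eq ht hC, ev_add]

/-! ## The increment of the odd witness on a `t`-piece -/

/-- The autocorrelation `∫ G(x+t)G(x) dx = 2∫F(x+t)F(x) dx − ∫F(x+t)F(−x) dx` for `t ≥ 0` (of the four terms of
`(F(x+t) − F(−x−t))(F(x) − F(−x))`, the two diagonal ones agree after `x ↦ −x ↦ x + t`, and `∫F(−x−t)F(x)` vanishes: the supports
`[0,b]` and `(−∞, −t]` meet in a null set). -/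
theorem integral_pwG_shift_mul {b : ℚ} {P : List Pw} (h : pwInside b P = true) {t : ℝ} (ht : 0 ≤ t) :
    ∫ x, pwG P (x + t) * pwG P x =
      2 * (∫ x, pwF P (x + t) * pwF P x) - (∫ x, pwF P (x + t) * pwF (pwMirror P) x) := by
  set f1 : ℝ → ℝ := fun x ↦ pwF P (x + t) * pwF P x with hf1
  set f2 : ℝ → ℝ := fun x ↦ pwF P (x + t) * pwF P (-x) with hf2
  set f3 : ℝ → ℝ := fun x ↦ pwF P (-x - t) * pwF P x with hf3
  set f4 : ℝ → ℝ := fun x ↦ pwF P (-x - t) * pwF P (-x) with hf4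
  have i1 : Integrable f1 := integrable_pwF_shift_mul_pwF t P P
  have ef2 : f2 = fun x ↦ pwF P (x + t) * pwF (pwMirror P) x := by
    funext x; simp only [hf2, pwF_neg P x]
  have i2 : Integrable f2 := by rw [ef2]; exact integrable_pwF_shift_mul_pwF t P (pwMirror P)
  -- f3 = F(x)·F(−x−t) = 0 off {0}
  have hT3 : f3 =ᵐ[volume] fun _ ↦ (0 : ℝ) := by
    have h0m : volume ({(0 : ℝ)} : Set ℝ) = 0 := measure_singleton 0
    refine (measure_eq_zero_iff_ae_notMem.1 h0m).mono fun x hx ↦ ?_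
    show pwF P (-x - t) * pwF P x = 0
    have hx0 : x ≠ 0 := by simpa using hx
    rcases lt_or_gt_of_ne hx0 with hlt | hgt
    · rw [pwF_eq_zero h (Or.inl hlt), mul_zero]
    · rw [pwF_eq_zero h (x := -x - t) (Or.inl (by linarith)), zero_mul]
  have i3 : Integrable f3 := (integrable_zero ℝ ℝ volume).congr hT3.symm
  -- ∫ f4 = ∫ f1 by x ↦ −x then x ↦ x + t
  have hT4 : ∫ x, f4 x = ∫ x, f1 x := by
    have e4 : ∀ x, f4 x = (fun y ↦ f1 (y - t)) (-x) := fun x ↦ by simp only [hf1, hf4]; ring_nf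
    simp_rw [e4]
    rw [integral_neg_eq_self (fun y ↦ f1 (y - t)) volume, integral_sub_right_eq_self f1 t]
  have i4 : Integrable f4 := by
    have := (i1.comp_add_right (-t)).comp_neg
    refine this.congr (Eventually.of_forall fun x ↦ ?_)
    simp only [hf1, hf4]; ring_nf
  have e : ∀ x, pwG P (x + t) * pwG P x = (f1 x + f4 x) - (f2 x + f3 x) := fun x ↦ by
    simp only [hf1, hf2, hf3, hf4, pwG, show -(x + t) = -x - t by ring]; ring
  simp_rw [e]
  have i14 : Integrable (fun x ↦ f1 x + f4 x) := i1.add i4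
  have i23 : Integrable (fun x ↦ f2 x + f3 x) := i2.add i3
  rw [integral_sub i14 i23, integral_add i1 i4, integral_add i2 i3, hT4, integral_congr_ae hT3,
    integral_const, smul_zero, add_zero, ef2]
  ring

/-- `x ↦ G(x)²` and `x ↦ G(x+t)G(x)` are integrable. -/
theorem integrable_pwG_shift_mul {b : ℚ} {P : List Pw} (h : pwInside b P = true) (hb : 0 < b) (t : ℝ) :
    Integrable fun x ↦ pwG P (x + t) * pwG P x := by
  have hW := isMarkovWitness_pwWitness h hb
  obtain ⟨_, hbd, hz, _, _, _⟩ := hW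
  refine SemilocalMarkov.integrable_of_norm_le_of_eq_zero (C := (2 * pwAbsBound P : ℝ) * (2 * pwAbsBound P)) (R := b)
    ((((measurable_pwF P).sub ((measurable_pwF P).comp measurable_neg)).comp (measurable_id.add_const t)).mul
      ((measurable_pwF P).sub ((measurable_pwF P).comp measurable_neg))).aestronglyMeasurable (fun x ↦ ?_) (fun x hx ↦ ?_)
  · have h1 := hbd (x + t); have h2 := hbd x
    rw [pwWitness, Complex.norm_real, Real.norm_eq_abs] at h1 h2
    rw [norm_mul, Real.norm_eq_abs, Real.norm_eq_abs]
    exact mul_le_mul h1 h2 (abs_nonneg _) ((abs_nonneg _).trans h1)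
  · have := hz x hx
    rw [pwWitness, Complex.ofReal_eq_zero] at this
    rw [this, mul_zero]

/-- **The increment list on a `t`-piece**: `4N − 4·Σ C(P,P) + 2·Σ C(P, mirror P)`, `N = pwNormSqF P`
(`D = 2‖G‖² − 2A`, `‖G‖² = 2N`, `A = 2ΣC(P,P) − ΣC(P, mirror P)`). -/
def pwIncrementL (P : List Pw) (T0 T1 : ℚ) : Option (List ℚ) :=
  match crossSumL T0 T1 P P, crossSumL T0 T1 P (pwMirror P) with
  | some C1, some C2 => some (add [4 * pwNormSqF P] (add (smul (-4) C1) (smul 2 C2)))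
  | _, _ => none

/-- **INCREMENT IDENTITY on a valid `t`-piece**: `D(t) = ev D t` for `t ∈ [T₀, T₁]`, `T₀ ≥ 0`. -/
theorem weilIncrement_pwWitness_eq {b : ℚ} {P : List Pw} (h : pwInside b P = true) (hd : pwDisjoint P = true)
    (hb : 0 < b) {T0 T1 : ℚ} {D : List ℚ} (hD : pwIncrementL P T0 T1 = some D) (hT0 : 0 ≤ T0) {t : ℝ}
    (ht : t ∈ Icc (T0 : ℝ) T1) : weilIncrement (pwWitness P) t = ev D t := by
  have ht0 : 0 ≤ t := le_trans (by exact_mod_cast hT0) ht.1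
  -- polarisation
  unfold weilIncrement
  have e : ∀ x, ‖pwWitness P (x + t) - pwWitness P x‖ ^ 2 =
      (‖pwWitness P (x + t)‖ ^ 2 + ‖pwWitness P x‖ ^ 2) - 2 * (pwG P (x + t) * pwG P x) := fun x ↦ by
    simp only [pwWitness, ← Complex.ofReal_sub, Complex.norm_real, Real.norm_eq_abs, sq_abs]; ring
  simp_rw [e]
  have hW := isMarkovWitness_pwWitness h hb
  have h2 : Integrable fun x ↦ ‖pwWitness P x‖ ^ 2 := hW.integrable_norm_sq
  have h1 : Integrable fun x ↦ ‖pwWitness P (x + t)‖ ^ 2 := h2.comp_add_right t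
  have h3 := integrable_pwG_shift_mul h hb t
  have h12 : Integrable fun x ↦ ‖pwWitness P (x + t)‖ ^ 2 + ‖pwWitness P x‖ ^ 2 := h1.add h2
  have h3' : Integrable fun x ↦ 2 * (pwG P (x + t) * pwG P x) := h3.const_mul 2
  rw [integral_sub h12 h3', integral_add h1 h2, integral_const_mul,
    integral_add_right_eq_self (fun x ↦ ‖pwWitness P x‖ ^ 2) t, integral_norm_sq_pwWitness h hd,
    integral_pwG_shift_mul h ht0]
  -- the lists
  unfold pwIncrementL at hD
  cases hC1 : crossSumL T0 T1 P P with
  | none => simp [hC1] at hD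
  | some C1 =>
    cases hC2 : crossSumL T0 T1 P (pwMirror P) with
    | none => simp [hC1, hC2] at hD
    | some C2 =>
      simp only [hC1, hC2, Option.some.injEq] at hD
      subst hD
      rw [integral_crossSum_eq ht hC1, integral_crossSum_eq ht hC2, ev_add, ev_add, ev_smul, ev_smul, ev_cons, ev_nil]
      push_cast
      ring

/-- `D(t) = 2‖G‖² = 4·pwNormSqF P` for `t > 2b` (disjoint supports). -/
theorem weilIncrement_pwWitness_eq_of_lt {b : ℚ} {P : List Pw} (h : pwInside b P = true) (hd : pwDisjoint P = true)
    (hb : 0 < b) {t : ℝ} (ht : 2 * (b : ℝ) < t) : weilIncrement (pwWitness P) t = 4 * (pwNormSqF P : ℝ) := by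
  have hb' : (0 : ℝ) < b := by exact_mod_cast hb
  unfold weilIncrement
  have e : ∀ x, ‖pwWitness P (x + t) - pwWitness P x‖ ^ 2 =
      (‖pwWitness P (x + t)‖ ^ 2 + ‖pwWitness P x‖ ^ 2) - 2 * (pwG P (x + t) * pwG P x) := fun x ↦ by
    simp only [pwWitness, ← Complex.ofReal_sub, Complex.norm_real, Real.norm_eq_abs, sq_abs]; ring
  simp_rw [e]
  have hW := isMarkovWitness_pwWitness h hb
  obtain ⟨_, _, hz, _, _, _⟩ := hW
  have hzero : ∀ x, pwG P (x + t) * pwG P x = 0 := fun x ↦ by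
    by_cases hx : (b : ℝ) < |x|
    · have := hz x hx; rw [pwWitness, Complex.ofReal_eq_zero] at this; rw [this, mul_zero]
    · have hx' : (b : ℝ) < |x + t| := by
        rw [not_lt] at hx
        have : -(b : ℝ) ≤ x := by linarith [abs_le.1 hx |>.1]
        rw [abs_of_pos (by linarith)]; linarith
      have := hz (x + t) hx'; rw [pwWitness, Complex.ofReal_eq_zero] at this; rw [this, zero_mul]
  simp_rw [hzero, mul_zero, sub_zero]
  have h2 : Integrable fun x ↦ ‖pwWitness P x‖ ^ 2 := (isMarkovWitness_pwWitness h hb).integrable_norm_sq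
  have h1 : Integrable fun x ↦ ‖pwWitness P (x + t)‖ ^ 2 := h2.comp_add_right t
  rw [integral_add h1 h2, integral_add_right_eq_self (fun x ↦ ‖pwWitness P x‖ ^ 2) t, integral_norm_sq_pwWitness h hd]
  ring

/-! ## Kernel regression: one piece `[0,1]` with `p = x` reproduces the polynomial window `x·1_{[−1,1]}` -/

/-- The piecewise increment of the single piece `(0, 1, x)` (odd extension `x·1_{[−1,1]}`) agrees with the polynomial-window
increment `incrementL [0,1] 1` (`D(t) = 2t − t³/3`): `23/24` at `t = 1/2` (piece `[0,1]`) and `15/8` at `t = 3/2` (piece `[1,2]`). -/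
example : (selLowerL ⟨0, 1, [0, 1]⟩ ⟨0, 1, [0, 1]⟩ 0 1).isSome = true := by decide +kernel
example : (selUpperL ⟨0, 1, [0, 1]⟩ ⟨0, 1, [0, 1]⟩ 0 1).isSome = true := by decide +kernel
example : (crossTermL ⟨0, 1, [0, 1]⟩ ⟨0, 1, [0, 1]⟩ 0 1).isSome = true := by decide +kernel
example : (crossSumL 0 1 [⟨0, 1, [0, 1]⟩] [⟨0, 1, [0, 1]⟩]).isSome = true := by decide +kernel
example : (pwIncrementL [⟨0, 1, [0, 1]⟩] 0 1).isSome = true := by decide +kernel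
example : ((pwIncrementL [⟨0, 1, [0, 1]⟩] 0 1).map fun D ↦ evQ D (1 / 2)) = some (23 / 24) := by decide +kernel
example : evQ (incrementL [0, 1] 1) (1 / 2) = 23 / 24 := by decide +kernel
example : ((pwIncrementL [⟨0, 1, [0, 1]⟩] 1 2).map fun D ↦ evQ D (3 / 2)) = some (15 / 8) := by decide +kernel
example : evQ (incrementL [0, 1] 1) (3 / 2) = 15 / 8 := by decide +kernel

end Summit.RiemannHypothesis.RiemannHypothesis.Theorems.SemilocalPolyWitness

end
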